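import Mathlib
import HarnessLib
import HarnessLib.Audit
import Summits.RiemannHypothesis.Statement
import Literature.Probability.LatticeModels.IsingLimitLaw
import Literature.NumberTheory.LFunctions.DeBruijnNewman
import Literature.NumberTheory.LFunctions.RiemannXi
import Literature.Probability.LatticeModels.IsingLimitLawNewmanProofs
import Literature.NumberTheory.LFunctions.PolyaKernelRHProofs
import HarnessLib.Audit.Status.Attr

/-!
Route: LeeYang

DORMANT since 2026-08-22T20:54:12Z (reconciler: no traction for 5.6 d (last activity item-evidence-added at 2026-08-17T04:37:25Z); parked, not closed — `ledger route dormant route-RiemannHypothesis-LeeYang --off` to reactivate) — unstaffed, not closed; items shared with open routes are served there. `ledger route dormant <id> --off` reactivates.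

# Route LeeYang — Ξ as an Ising partition function: the de Bruijn kernel is a ferromagnetic
magnetisation law

**Thesis X (words).** The probability law `ν_Φ = Φ(u) du / ∫Φ` on ℝ — `Φ =
Literature.NumberTheory.LFunctions.deBruijnPhi`, the Pólya–de Bruijn kernel, with `∫_ℝ e^{zu} Φ(u)
du = 2·H₀(iz)`, `H₀(x) = ξ(1/2 + ix/2)/8`, so `∫_ℝ e^{hu} Φ = ξ(1/2 + h/2)/4` — is an *Ising limit
law* (`Literature.Probability.LatticeModels.IsIsingLimitLaw`): a weak limit, with `∫
e^{bu²}`-moments bounded uniformly along the sequence for every `b`, of laws of weighted total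
magnetisations `Σ_i w_i σ_i` (`w_i ≥ 0`) of FINITE spin-½ ferromagnets (pair couplings `J_ij ≥ 0`,
zero field). Then `ν_Φ` has the Lee–Yang property by Newman's closure theorem (PROVED in tree:
`Literature.Probability.LatticeModels.hasLeeYangProperty_of_isIsingLimitLaw_holds`, from the finite
circle theorem `lee_yang_circle_theorem_finite_holds` via Asano contractions + Hurwitz), i.e. every
zero of `z ↦ ∫ e^{zu} Φ` is imaginary, i.e. every zero of `Ξ` is real — RH
(`Literature.NumberTheory.LFunctions.riemannHypothesis_of_deBruijnPhi_laplace_zeros_holds`). X is C.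
M. Newman's 1991 suggestion ("ξ as the partition function of a ferromagnet") made precise; it is a
CONSTRUCTION claim about finite ferromagnets — apparently strictly stronger than RH (RH ⇒ X is not
known) and refutable without touching RH (item `LeeyangNeg` = ¬X literally: both quantify over the
one law `ν_Φ`, which its defining equation pins down by
`MeasureTheory.ProbabilityMeasure.toMeasure_injective`).

Lean: `∀ ν : MeasureTheory.ProbabilityMeasure ℝ, (ν : MeasureTheory.Measure ℝ) = (∫⁻ u,
ENNReal.ofReal (Literature.NumberTheory.LFunctions.deBruijnPhi u))⁻¹ •
MeasureTheory.volume.withDensity (fun u => ENNReal.ofReal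
(Literature.NumberTheory.LFunctions.deBruijnPhi u)) →
Literature.Probability.LatticeModels.IsIsingLimitLaw ν`

(= item `LeeyangThesis`; the hypothesis is satisfiable — `ν_Φ` IS a probability measure,
`Summit.RiemannHypothesis.LeeYang.exists_probabilityMeasure_eq_deBruijnLaw` — so X is not vacuous.)

**Deciding theorem (D-0027 §2.1; CRUX-ONLY since route-repair g3, 2026-08-16, gate native check
ok).** `closes (hX : LeeyangThesis) : Summit.RiemannHypothesis`, PROVED INLINE in this file (≈ 45
lines, axioms propext/Classical.choice/Quot.sound): `∫Φ ∈ (0, ∞)`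
(`Literature.NumberTheory.LFunctions.integrable_exp_mul_deBruijnPhi 0`, `deBruijnPhi_pos_holds`,
`continuous_deBruijnPhi`) makes `ν_Φ` a probability measure; X makes it an Ising limit law; Newman's
closure theorem (tree theorem
`Literature.Probability.LatticeModels.hasLeeYangProperty_of_isIsingLimitLaw_holds`) gives `ν_Φ` the
Lee–Yang property; its Laplace transform is `(∫Φ)⁻¹ ∫ e^{zu} Φ`, so every zero of `z ↦ ∫ e^{zu} Φ`
is imaginary, and Pólya's representation
(`Literature.NumberTheory.LFunctions.riemannHypothesis_of_deBruijnPhi_laplace_zeros_holds`) yields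
RH. So the route decides RH from the single crux X = `LeeyangThesis` (rank-0 slot; auto-cruxed
2026-08-16 — it is Newman's open conjecture); no support item is a hypothesis of `closes` any more.
The former frame item `LeeyangThesisImpliesRH` (support, rank 9) is CLOSED
(`Theorems/LeeYangLeeyangThesisImpliesRH.lean`, `leeyangThesisImpliesRH_proof := closes`). TREE
HYGIENE (route-repair 2026-08-17, lint `tree.conditional`): the bookkeeping file
`Theorems/LeeYangLeeyangThesis.lean` still carries three theorems with hypotheses that can never be
registered by name — `leeyangNeg_of_not_riemannHypothesis (hN :
hasLeeYangProperty_of_isIsingLimitLaw) (h : ¬ Summit.RiemannHypothesis) : LeeyangNeg`,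
`riemannHypothesis_of_leeyangThesis (hN) (hX : LeeyangThesis) : Summit.RiemannHypothesis`,
`riemannHypothesis_of_isIsingLimitLaw_of_eq (hν) (hN) (h : IsIsingLimitLaw ν) :
Summit.RiemannHypothesis` (`hN` is DISCHARGED in tree by
`hasLeeYangProperty_of_isIsingLimitLaw_holds`; `Not`- /`Eq`-headed binders are not obligations) — all
three audit as `proof.conditional` today (planner re-run of `#h21_tree_audit`, 2026-08-17). Repair
filed, not yet landed: the contrapositive is now the registered support item #10
`NotRHImpliesLeeyangNeg` (stmt-RiemannHypothesis-17751), and the certified two-file restate —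
`Theorems/LeeYangLeeyangThesisImpliesRH.lean` (signatures unchanged; drops its import of the
bookkeeping file) then `Theorems/LeeYangLeeyangThesis.lean` (hN discharged;
`laplace_zeros_of_isIsingLimitLaw_of_eq`; `riemannHypothesis_of_leeyangThesis (hX) :
Summit.RiemannHypothesis`; `theorem notRHImpliesLeeyangNeg_proof : NotRHImpliesLeeyangNeg`; lean
check rc 0, file audit 0 conditional / 0 orphan) — is attached as evidence to 17751; Theorems being
prover-only and append-only (D-0016), it lands through a prover seat (`--workitem
stmt-RiemannHypothesis-17751`, review-queued) or an operator `--maintenance` write, and that clears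
the lint.

Rationale: WHY THIS LINE. Import from rigorous statistical mechanics, with an explicit dictionary: partition
function `Z(h)` ↔ `ξ(1/2 + h/2) = 4∫e^{hu}Φ`; magnetisation law ↔ `ν_Φ = Φ du/∫Φ`; imaginary field ↔
critical line; Lee–Yang circle theorem [LeeYang1952 App. II; Asano1970; Newman1974 Thm 3;
LiebSokal1981 §2–3] ↔ RH; de Bruijn–Newman `Λ_DN` ↔ its Ising analogue [Newman1976; NewmanWu2020].
The class of Ising limit laws is closed under weak limits with Gaussian-moment control and under
ferromagnetic tilts `e^{cu²}` (tree: `IsingLimitLawClosure`, `IsingLimitLawTilt`), contains the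
two-point laws and `e^{−au⁴−bu²} du` [GriffithsSimon1973 Thm 1], and every member inherits the
spin-½ ferromagnetic inequalities (GHS [EllisMonroeNewman1976], Lebowitz/Shlosman Ursell signs
[Shlosman1986], Newman's Gaussian domination [Newman1975]) — so X is testable by concrete
inequalities for `ξ` on the REAL axis, and refutable independently of RH. As of 2026-08-15 the whole
Ising side of the dictionary is PROVED in Literature — `lee_yang_circle_theorem_finite_holds` (Asano
contractions), `lee_yang_ising_holds` (zero weights), `hasLeeYangProperty_of_isIsingLimitLaw_holds`
(Newman closure: locally uniform convergence of Laplace transforms + Hurwitz),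
`ghs_isingMagnetizationLaw_holds`, `isIsingLimitLaw_phi4_holds` (Simon–Griffiths via Curie–Weiss
block densities) — and so is the ζ side (`riemannHypothesis_of_deBruijnPhi_laplace_zeros_holds`,
Pólya's representation): the route's cone has 0 unproved facts and its ENTIRE open content is the
construction X = Newman's 1991 conjecture [Newman1991; Dimitrov2013 §4.3] plus its calibration #2.
Distinct from DBN (heat flow in `t`; this line only ever produces `Λ_DN ≤ 0`, never `< 0`) and from
TotalPositivity (PF sequences): the object is a limit of finite Gibbs measures and the tools are
Asano contractions and correlation inequalities, not order/type of entire functions.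

RANKED CRUXES. #2 LeeyangPolyaKernelIsingLimit (crux) — Pólya calibration: the law ∝
`cosh(9u/2)·exp(−2π cosh 2u) du` (Pólya's leading-term kernel, whose cosine transform is KNOWN to
have only real zeros [Polya1926; Titchmarsh1986 §10.1, §10.23]) is an Ising limit law; decides
whether ferromagnetic spin-½ approximation reaches doubly-exponential kernels at all, with the
Lee–Yang conclusion already a theorem (why it might fail: the printed Griffiths–Simon-class members
are two-point laws and `e^{−au⁴−bu²}` — single critical Curie–Weiss blocks, the `Λ = −∞` class of
[Newman1976 Thm 2; NewmanWu2020 Thm 10] — and Pólya's kernel is outside that class, so witnesses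
must be marginally-ferromagnetic multi-block designs, none in print; sources: Polya1926, Newman1976,
NewmanWu2020 §2.5, GriffithsSimon1973, EllisMonroeNewman1976 Thm 1.2(c)). #6 LeeyangNeg (crux) — ¬X,
the route-killer, literally `¬ LeeyangThesis` (same law `ν_Φ`; whoever settles either item closes
the other in three lines): exhibit an inequality valid for every Ising limit law (stable under `w ≥
0` sums and weak limits with moment control) that `ν_Φ` violates (why it might fail: every
RH-independent test run so far passes — `Φ ∈ G₋` by [Newman1991] + [EllisMonroeNewman1976 Thm
1.2(c)] so all GHS-type tests hold, cumulant signs hold numerically, LY-derived bounds [Newman1975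
Thm 3–6] are implied by RH, density-shape tests are invalid because two-point laws are Ising laws; a
kill needs a finer built-from-spin-½ inequality, none known; sources: Newman1991,
EllisMonroeNewman1976, Newman1975, Newman1976 (1.7)). #0 LeeyangThesis (crux, rank-0 slot) — X
itself, the ONLY hypothesis of `closes` (crux-only deciding theorem, proved inline 2026-08-16);
auto-cruxed by the gate 2026-08-16 (conjecture-grade: it is Newman's open 1991 conjecture and in
difficulty the apex of the route, above #2) (why it might fail: Λ_DN ≥ 0 [RodgersTaoFMP2020 =
Literature.NumberTheory.LFunctions.rodgers_tao] forbids every witness sequence with a uniform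
ferromagnetic margin, and all printed Griffiths–Simon members are single-block; sources: Newman1991,
Dimitrov2013 §4.3, NewmanWu2020 Thm 10–11, AizenmanDuminilCopin2021 Def 2.1). Frame and support
items (do not key staffing): #9 LeeyangThesisImpliesRH (support) = X → RH, CLOSED
(`leeyangThesisImpliesRH_proof := closes`, Theorems/LeeYangLeeyangThesisImpliesRH.lean). #10
NotRHImpliesLeeyangNeg (support; stmt-RiemannHypothesis-17751, filed by route-repair 2026-08-17) =
`¬ Summit.RiemannHypothesis → LeeyangNeg`, the contrapositive face of #9 and the route's kill
interface as ONE registered implication (provable now in one line: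
`leeyangNeg_iff_not_leeyangThesis.2 fun hX => h (closes hX)`); it is the registered home of the
bookkeeping theorem `Summit.RiemannHypothesis.LeeYang.leeyangNeg_of_not_riemannHypothesis`, whose `¬
RiemannHypothesis` hypothesis is unregistrable by name (the route's `tree.conditional` lint,
together with the two `hN`-conditional RH lemmas of the same file). PROVE #10 BY LANDING the two
certified restates attached to 17751 as evidence, in order: (1)
Theorems/LeeYangLeeyangThesisImpliesRH.lean (signatures unchanged), (2) the whole-file restate of
Theorems/LeeYangLeeyangThesis.lean (`ledger propose --kind proof --target
Summits/RiemannHypothesis/RiemannHypothesis/Theorems/LeeYangLeeyangThesis.lean --file <evidence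
LeeYangLeeyangThesis_restate.lean> --workitem stmt-RiemannHypothesis-17751`; append-only deviation ⇒
review-queued, expected) — NOT by a new file that calls the old conditional theorem, which would
close the item and leave the lint. #1 Assembly (legacy assembly item, off the deciding path) =
Lee–Yang property of `Φ du` ⇒ RH; now ONE LINE: it is definitionally the discharged fact
`Literature.NumberTheory.LFunctions.riemannHypothesis_of_deBruijnPhi_laplace_zeros_holds`
(PolyaKernelRHProofs.lean). #4 LeeYangCircleTheoremFinite (support) = verbatim
`Literature.Probability.LatticeModels.lee_yang_circle_theorem_finite`, discharged
(`lee_yang_circle_theorem_finite_holds`, LeeYangProofs.lean) — one line. #3 LeeyangGhsFaceXi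
(support) = `(log ξ)′` concave on `[1/2, ∞)`, the GHS face of X; KNOWN in print ([Newman1991]: `V′`
convex for `Φ = e^{−V}`; [EllisMonroeNewman1976 Thm 1.2(c) + Thm 1.1 at N = 1]) and numerically
`(log ξ)‴ < 0` on `(1/2, 800]`; prove by vendoring Newman1991 as a named fact + the one-site GHS
computation, or by certified numerics + Stirling asymptotics `(log ξ)‴ ∼ −1/(2σ²)`. #5
LeeyangCumulantAlternationXi (support) = `0 < (−1)^{n+1}(log ξ)^{(2n)}(1/2)` for `n ≥ 1` (Lebowitz
at n = 2; [Newman1975 Thm 3] under LY); unconditional proof = first zero `1/2 + 14.1347i` dominates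
+ certified tail, using `xiTaylorCoeff` (RiemannXi.lean).

KILL CRITERIA. #6 proved (any spin-½-inherited inequality certifiedly violated by `ν_Φ` — e.g. #3 or
#5 refuted at one certified point) closes the route `refuted: LeeyangThesis`. #2 refuted by an
obstruction that is not specific to the `cosh(9u/2)` factor (e.g. "no Ising limit law has a
real-analytic density with `log`-tail `≍ −e^{κ|u|}`") closes it as well. Already-known constraint,
recorded in the Barriers field: `Λ_DN ≥ 0` (`Literature.NumberTheory.LFunctions.rodgers_tao`)
excludes every witness sequence with a uniform ferromagnetic margin `J^{(k)}_{ij} ≥ c·w_i w_j`, `c >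
0` (else `e^{−cu²}Φ du` would be an Ising limit law, hence Lee–Yang, i.e. `Λ_DN ≤ −c`); a proof that
EVERY Ising limit law with a smooth positive density admits such a margin would kill X outright. Not
a kill: tail-thinness (two-point laws are compactly supported Ising laws), log-concavity/unimodality
of the density, Gaussian domination (implied by RH).

NOT DECOMPOSED YET. No approximating architecture is fixed (by the `Λ_DN ≥ 0` constraint it must be
marginally ferromagnetic: products/hierarchies of near-critical blocks with vanishing
cross-coupling-to-weight ratio — Curie–Weiss, hierarchical and Griffiths analogue-spin blocks are
all candidates); no continuous-spin intermediate layer (EMN `G₋` / Lieb–Sokal one-component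
ferromagnets with `φ⁴`-type single-site laws, which are themselves Ising limits by Simon–Griffiths);
the converse RH ⇒ LY(`Φ du`) (calibration only) is not filed; #3/#5 are not split into numerics +
asymptotics until a prover asks.

TWO-LAYER PLAN. Foreseen glued split of X once #2 moves: X ⇐ S1 → S2 → X with S1 = "IsIsingLimitLaw
is closed under ferromagnetic block coupling: if ν₁, ν₂ are Ising limit laws and `J ≥ 0` then the
law of `u₁ + u₂` under `e^{J u₁ u₂} ν₁ ⊗ ν₂ / Z` is one, and under weak limits with moment control"
(Literature-level, provable like `IsingLimitLawTilt`/`Closure`), S2 = "`ν_Φ` lies in the sequential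
closure of {two-point laws, `e^{−au⁴−bu²} du`} under scaling, convolution, ferromagnetic block
coupling and such limits" (the construction proper); k = 2, depth 1.

CHEAPEST FALSIFIER. One interval-arithmetic job on the (rapidly convergent, explicitly summable)
even moments `m_{2n} = ∫u^{2n}Φ/∫Φ`, `n ≤ 50`: check the spin-½-inherited battery —
Shlosman/Lebowitz sign alternation of the cumulants of `ν_Φ` (= #5, [Shlosman1986] makes it
RH-independent on the Ising side) and Newman's Gaussian moment domination `m_{2n} ≤ (2n−1)!!·m₂^n`
[Newman1975]; a single certified violation proves #6, closes the route and (both being consequences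
of the Lee–Yang property) would refute RH itself — so it is expected to pass, which is the
diagnostic point: every cheap single-law test of X is also a test of RH, and the first genuinely
X-specific (RH-independent, unknown) content is architectural, crux #2. Second cheapest, a lookup:
any printed necessary condition for Griffiths–Simon-class membership beyond GHS
([EllisMonroeNewman1976; AizenmanDuminilCopin2021 Def 2.1; NewmanWu2020 Thm 10–11]) evaluated on `Φ`
— none found by the 2026-08-14 searches.

Novelty: NOVELTY (retriage 2026-08-14; searched: lit search "GHS inequality Riemann hypothesis", "Knauf
ferromagnetic spin chain zeta Lee-Yang", "Griffiths-Simon class single-spin measure"; lit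
bridges/frontier RiemannHypothesis; lit galaxy pdf/crabby "GHS inequality and the Riemann
hypothesis" (0 hits); Springer abstract of Newman1991 read; NewmanWu2020, Dimitrov2013,
AizenmanDuminilCopin2021, EMN1976 read at page level).
Nearest prior art:
(1) [Newman1991] C. M. Newman, "The GHS inequality and the Riemann hypothesis", Constr. Approx. 7
(1991) 389–399 (abstract; full text acq-00694): with Ξ(x/2) = 4∫exp(ixt − V(t))dt — i.e. e^{−V} =
Literature.NumberTheory.LFunctions.deBruijnPhi exactly — proves V′ CONVEX on [0,∞) (strengthening
the earlier "V′(t)/t is increasing on (0,∞)" from the moment-inequality papers it cites,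
[CsordasNorfolkVarga1986]/Csordas–Varga 1988), "a property related to the GHS inequality of
statistical mechanics"; keywords "Ising model, Lee–Yang theorem"; "the possible relevance of the
convexity of V′ to the Riemann Hypothesis is discussed". With [EllisMonroeNewman1976, Thm 1.2(c)]
this puts Φ dt in the GHS class G₋. [Dimitrov2013, §4.3 p.10]: "A natural conjecture which has been
discussed in the literature is that ξ(iz) is a partition function of a general Ising model related
to a quantum field theory (see [New91])". So the THESIS IDEA — Φ du as a ferromagnetic magnetisation
law, Lee–Yang ⇒ RH, ferromagnetic inequalities as RH-independent necessary conditions — is Ne  [refs: Newman1991, NewmanWu2020, Dimitrov2013, AizenmanDuminilCopin2021, CsordasNorfolkVarga1986, EllisMonroeNewman1976, GriffithsSimon1973, Knauf1993, Wolf2020, Newman1976]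

Barriers (technique_class: Lee-Yang Griffiths-Simon-class Ising-approximation GHS): BARRIERS (catalogue Literature/Barriers/RiemannHypothesis/, checked 2026-08-14):
- Literature.Barriers.RiemannHypothesis.NewmanConjecture (Λ_DN ≥ 0; = fact
Literature.NumberTheory.LFunctions.rodgers_tao [RodgersTaoFMP2020 Thm 1.1]): APPLIES AS A
CONSTRAINT, formally evaded. X yields the Lee–Yang property only for the ferromagnetic tilts
e^{+bu²}Φ du, b ≥ 0 (adding couplings b·w_i w_j ≥ 0), i.e. Λ ≤ 0 — never Λ < 0 — so the conclusion
does not "survive the backward heat flow" and the barrier's blocked class (DeBruijnRoute, t < 0) is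
not entered. But the barrier bites the CONSTRUCTION: a witness sequence with uniform ferromagnetic
margin J^{(k)}_{ij} ≥ c·w_i w_j (i ≠ j) for one fixed c > 0 would make e^{−cu²}Φ du an Ising limit
law, hence Lee–Yang (fact hasLeeYangProperty_of_isIsingLimitLaw), i.e. Λ ≤ −c < 0 — impossible. So
single-block Curie–Weiss / Griffiths–Simon architectures (the only ones in print; they land in the Λ
= −∞ class of [Newman1976 Thm 2; NewmanWu2020 Thm 10]) are excluded for X, and likewise for crux
LeeyangPolyaKernelIsingLimit (Pólya's kernel is outside the Λ = −∞ class by the same theorem);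
witnesses must be asymptotically marginally ferromagnetic (products/hierarchies of blocks with
vanishing cross-coupling-to-weight ratio).
- Literature.Barriers.RiemannHypothesis.DavenportHeilbronn and
Literature.Barriers.RiemannHypothesis.EpsteinZetaRealZeros (no argument using only Dirichlet series
+ functional equation/Ξ-structure can prove RH: Davenport–Heilbronn's f

Novelty grade: variant — refuter route-review grade (rreview1, 2026-08-15): THESIS = Newman 1991's published suggestion (Phi = e^{-V} as a ferromagnetic single-spin law; Dimitrov2013 p.10: 'natural conjecture ... xi(iz) is a partition function of a general Ising model ... [New91]') => the mechanism is KNOWN as a conjecture; (refuter refuter-rreview1-RiemannHypothesis-LeeYang-aa20217c-0, 2026-08-15T18:29:47Z; prior: Newman1991 (doi:10.1007/bf01888165); Dimitrov2013 §4.3 p.10 (arXiv:1311.0596); EllisMonroeNewman1976 Thm 1.2(c) + (1.9); SimonGriffiths1973 Thm 1; AizenmanBarskyFernandez1987 JSP 47 §4; NewmanWu2020 §2.5)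

History (route lifecycle, newest last):
- 2026-08-16T04:16:21Z · AUTO-CRUX (backfill): LeeyangThesis — hypotheses of the deciding theorem that nothing in the route derives are cruxes (operator:999:1085951)
- 2026-08-22T20:54:12Z · DORMANT — reconciler: no traction for 5.6 d (last activity item-evidence-added at 2026-08-17T04:37:25Z); parked, not closed — `ledger route dormant route-RiemannHypothesi (operator:999:3841283)

sub-problem: RiemannHypothesis · status: dormant · opened planner-RiemannHypothesis-Survey-0 2026-08-13T06:49:31Z · rev 7 · ledger route-RiemannHypothesis-LeeYang
GENERATED by the gate from the ledger (D-0016/17). Provers cite these decls: `theorem foo : Summit.RiemannHypothesis.RiemannHypothesis.Theses.LeeYang.<Decl> := …` in Summits/RiemannHypothesis/RiemannHypothesis/Theorems/<Name>.lean.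
-/

namespace Summit.RiemannHypothesis.RiemannHypothesis.Theses.LeeYang

open scoped BigOperators Topology Manifold Classical MeasureTheory ProbabilityTheory Matrix InnerProductSpace ComplexConjugate ContinuousMap
open Filter Set Function TopologicalSpace MeasureTheory

attribute [summit_statement] _root_.Summit.RiemannHypothesis

open Summit

/-- item stmt-RiemannHypothesis-0451 · crux (kind.auto-crux: conjecture-grade) · rank 0 · open · by planner
why it might fail: X ⇒ RH, and X is Newman's OPEN 1991 conjecture (Φdu ∈ Griffiths–Simon class). Λ_DN ≥ 0 (rodgers_tao) kills every witness with uniform margin J_ij ≥ c·w_i·w_j, c > 0 (e^{−cu²}Φdu would be Lee–Yang ⇒ Λ ≤ −c); printed GS members are single-block (Λ = −∞ class): no multi-block architecture is known.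
sources: Newman1991 (doi:10.1007/bf01888165, abstract: V′ convex on [0,∞); relevance to RH discussed), Dimitrov2013 §4.3 p.10 (arXiv:1311.0596: 'natural conjecture … ξ(iz) is a partition function of a general Ising model … [New91]'), RodgersTaoFMP2020 Thm 1.1 = Literature.NumberTheory.LFunctions.rodgers_tao; barrier Literature.Barriers.RiemannHypothesis.NewmanConjecture, NewmanWu2020 Thm 10–11 and §2.5 p.7 (arXiv:1901.06596), AizenmanDuminilCopin2021 Def 2.1 p.7 (arXiv:1912.07973: GS class = Literature.Probability.LatticeModels.IsIsingLimitLaw up to the moment clause), GriffithsSimon1973 (Literature.Probability.LatticeModels.isIsingLimitLaw_phi4)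
needs_definition: IsIsingLimitLaw (defn request filed,
Literature/Probability/LatticeModels/LeeYang.lean). Statement X: IsIsingLimitLaw ν_Φ where ν_Φ is
the probability measure on ℝ with density Literature.NumberTheory.LFunctions.deBruijnPhi u / ∫
Literature.NumberTheory.LFunctions.deBruijnPhi (Φ > 0, even, ∫e^{bu²}Φ < ∞ ∀ b: facts
deBruijnPhi_pos/deBruijnPhi_neg/deBruijnPhi_le_exp). IsIsingLimitLaw ν :⇔ ∃ finite ferromagnets (n_k
sites, couplings J^{(k)}_{ij} ≥ 0, zero field, free b.c.) and weights λ^{(k)}_i ≥ 0 such that the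
laws ν_k of Σ_i λ^{(k)}_i σ_i under the Gibbs measure ∝ exp(Σ_{i,j} J_{ij} σ_iσ_j) on {±1}^{n_k}
converge weakly to ν with sup_k ∫ e^{b u²} dν_k < ∞ for every b > 0. Since ∫_ℝ e^{hu}Φ(u)du = ξ(1/2
+ h/2)/4 (Literature.NumberTheory.LFunctions.deBruijnH_zero_eq at z = −ih, Φ even), X says: h ↦
ξ(1/2 + h/2) is a locally uniform limit of ferromagnetic Ising partition functions in the complex
field h. X ⇒ RH by Lee–Yang [LeeYang1952; Newman1974] + Hurwitz (assembly #1). RH ⇒ X is NOT known: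
X is a construction claim, refutable independently of RH (item #6). Sources: [Newman1976;
NewmanWu2020 §§3–5; GriffithsSimon1973 (φ⁴ law is an Ising limit); LiebSokal1981; Ruel -/
@[route_item "route-RiemannHypothesis-LeeYang", crux]
def LeeyangThesis : Prop :=
  ∀ ν : MeasureTheory.ProbabilityMeasure ℝ, (ν : MeasureTheory.Measure ℝ) = (∫⁻ u, ENNReal.ofReal (Literature.NumberTheory.LFunctions.deBruijnPhi u))⁻¹ • MeasureTheory.volume.withDensity (fun u => ENNReal.ofReal (Literature.NumberTheory.LFunctions.deBruijnPhi u)) → Literature.Probability.LatticeModels.IsIsingLimitLaw ν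

/-- item stmt-RiemannHypothesis-0453 · crux · rank 2 · closed · proved by Summit.RiemannHypothesis.RiemannHypothesis.Theorems.leeyangPolyaKernelIsingLimit_proof @ 508ce6acbbe2 (prover) · by planner
why it might fail: Printed GS-class members: two-point laws and e^{−au⁴−bu²} (one critical Curie–Weiss block; Λ=−∞ class). Φ*=cosh(9u/2)e^{−2πcosh2u} is outside that class (Newman1976 Thm 2): witnesses need marginally-ferromagnetic multi-block designs, none known; beyond quartic even LY can fail (SG1973).
sources: Polya1926; Titchmarsh1986 §10.1 p.185, §10.23 p.204 (fact Literature.NumberTheory.LFunctions.polya_fakeXi_real_zeros), Newman1976 Thm 2 p.246 / NewmanWu2020 Thm 10 p.7 (classification of the Λ = −∞ class), GriffithsSimon1973 (fact Literature.Probability.LatticeModels.isIsingLimitLaw_phi4); NewmanWu2020 §2.5 p.7 ('Lee–Yang property fails for some exp(−as⁶−bs⁴−cs²)'), AizenmanDuminilCopin2021 Def 2.1 (GS class), EllisMonroeNewman1976 Thm 1.2(c) + (1.9): Φ* ∈ G₋ (V′ convex, V″(0)=8π−81/4>0), so GHS is no obstruction, grounder-reground 2026-08-14: NEW (no print result on Ising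 approximability of Φ*)
needs_definition: IsIsingLimitLaw. Statement: IsIsingLimitLaw of the probability law on ℝ with
density proportional to Real.cosh (9u/2) * Real.exp (−2π Real.cosh (2u)). Calibration crux: this is
the leading term of Φ for |u| → ∞ and Pólya PROVED its cosine transform has only real zeros
[Polya1926; Titchmarsh1986 ch. X], so the Lee–Yang conclusion is already a theorem here; the
question isolates the stat-mech content of X — can weighted magnetisations of finite spin-½
ferromagnets (Griffiths analogue-spin blocks [GriffithsSimon1973], Curie–Weiss/hierarchical
couplings) approximate a law with doubly-exponential tails and this specific shape? A proof gives
the method for X (add the lower-order theta terms); a disproof that is not specific to the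
cosh(9u/2) factor kills the route. Tools: [Newman1974; LiebSokal1981; EllisMonroeNewman1976;
Ruelle2010; BorceaBranden2009]. -/
@[route_item "route-RiemannHypothesis-LeeYang"]
def LeeyangPolyaKernelIsingLimit : Prop :=
  ∀ ν : MeasureTheory.ProbabilityMeasure ℝ, (ν : MeasureTheory.Measure ℝ) = (∫⁻ u, ENNReal.ofReal (Real.cosh (9 * u / 2) * Real.exp (-(2 * Real.pi * Real.cosh (2 * u)))))⁻¹ • MeasureTheory.volume.withDensity (fun u => ENNReal.ofReal (Real.cosh (9 * u / 2) * Real.exp (-(2 * Real.pi * Real.cosh (2 * u))))) → Literature.Probability.LatticeModels.IsIsingLimitLaw ν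

/-- item stmt-RiemannHypothesis-0457 · crux · rank 6 · open · by planner
why it might fail: All RH-independent tests so far pass: Φ∈G₋ (Newman1991+EMN1976 Thm1.2c) so GHS-type tests hold; cumulant signs hold; LY-derived bounds (Newman1975 Thm3–6) are ⇔/weaker than RH; density-shape tests invalid (two-point laws ∈ GS). A kill needs a finer built-from-Ising inequality; none known.
sources: Newman1991; EllisMonroeNewman1976 Thm 1.1–1.2 pp.168–169, Newman1975 Thm 4 (2.5)–(2.6) p.3 (Gaussian domination is LY-only ⇒ not RH-independent), Newman1976 (1.7) p.247 (two-point laws are Lee–Yang/Ising laws ⇒ no log-concavity/unimodality/tail test), Newman1991 refs [2],[3],[16]: Brydges–Fröhlich–Sokal skeleton inequalities, Newman 1975 Gaussian correlation inequalities (Z. Wahrsch. 33) — the untested candidate family, refuter g26-1/g26-3 notes 2026-08-13 (valid test family = inequalities stable under w ≥ 0 sums + weak limits with moment control)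
needs_definition: IsIsingLimitLaw. Statement: ¬ IsIsingLimitLaw ν_Φ (ν_Φ as in #0). Route-killer,
independent of RH. Method: every Ising limit law inherits all spin-½ ferromagnetic inequalities that
are stable under weighted sums and weak limits — GKS, GHS (#3), Lebowitz/Newman sign rules (#5),
Newman's Gaussian domination for even Lee–Yang laws, E e^{hM} ≤ exp(h² E M² / 2) for real h
[Newman1975] (refuter to confirm hypotheses), Ellis–Newman/GHS consequences for the density (e.g.
unimodality/log-concavity properties of even ferromagnetic magnetisation laws,
[EllisMonroeNewman1976]) — and each becomes a certified-numerics inequality for ξ on the real axis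
or for Φ itself (Φ is explicit: Literature.NumberTheory.LFunctions.deBruijnPhi). First candidates to
test: log-concavity of Φ on ℝ (is u ↦ log Φ(u) concave? known facts: Φ > 0, even, decreasing on u >
0 [CsordasNorfolkVarga1986 Thm A]); Newman's Gaussian domination ξ(1/2 + h/2)/ξ(1/2) ≤ exp(h² κ₂/2)
for real h. -/
@[route_item "route-RiemannHypothesis-LeeYang"]
def LeeyangNeg : Prop :=
  ∀ ν : MeasureTheory.ProbabilityMeasure ℝ, (ν : MeasureTheory.Measure ℝ) = (∫⁻ u, ENNReal.ofReal (Literature.NumberTheory.LFunctions.deBruijnPhi u))⁻¹ • MeasureTheory.volume.withDensity (fun u => ENNReal.ofReal (Literature.NumberTheory.LFunctions.deBruijnPhi u)) → ¬ Literature.Probability.LatticeModels.IsIsingLimitLaw ν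

/-- item stmt-RiemannHypothesis-0454 · support · rank 3 · closed · proved by Summit.RiemannHypothesis.RiemannHypothesis.Theorems.leeyangGhsFaceXi_proof @ b0e5d1ec994c (prover) · by planner
why it might fail: None expected: it is a corollary of print results (see reason). Residual risk only in the reading of EMN Thm 1.1 at N = 1 (checked: p.168 'all (not necessarily distinct) sites i,j,k', N = 1 case = their ref. [2]) and the normalisation 4∫e^{ixt}Φ = Ξ(x/2) (= H21's).
sources: Newman1991 main theorem (V′ convex on [0,∞) for Φ = e^{−V}, 4∫exp(ixt−V(t))dt = Ξ(x/2)), EllisMonroeNewman1976 Thm 1.2(c) p.169 (e^{−V}, V′ convex ⇒ G₋) + Thm 1.1 p.168 (G₋ ⇒ GHS (1.4), h ≥ 0), tree: Literature.Probability.LatticeModels.ghs_isingMagnetizationLaw(_holds) is the spin-½ side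
Necessary for X: for a ferromagnetic spin-½ magnetisation M with weights λ ≥ 0, GHS
[GriffithsHurstSherman1970; EllisMonroeNewman1976] gives h ↦ (d/dh) log E e^{hM} concave on h ≥ 0;
this passes to Ising limit laws, and for Φ du it reads: σ ↦ (log ξ)'(σ) concave on [1/2, ∞), i.e.
(log ξ)''' ≤ 0 there (ξ = Literature.NumberTheory.LFunctions.riemannXi is real > 0 on ℝ; ‖·‖ avoids
choosing re). Planner finite-difference check: (log ξ)'''(σ) < 0 for σ ∈ (1/2, 800], matching the
asymptotic −1/(2σ²) from Stirling. Status: not found in the literature as a theorem; RH-implication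
unclear ((log ξ)''' = 2Σ_ρ (σ−ρ)^{−3} has mixed-sign terms); expected PROVABLE unconditionally by
certified computation on [1/2, σ₁] (first zeros dominate; zeros verified to 3·10^{12}
[PlattTrudgian2021] make the off-line tail negligible) plus the elementary bound 2/σ³ + 2/(σ−1)³ +
ψ''(σ/2)/8 − Σ Λ(n) log²n · n^{−σ} < 0 for σ ≥ σ₁. Refutation (certified point with (log ξ)''' > 0)
proves ¬X (item #6) and closes the route. -/
@[route_item "route-RiemannHypothesis-LeeYang"]
def LeeyangGhsFaceXi : Prop :=
  ConcaveOn ℝ (Set.Ici (1 / 2 : ℝ)) (deriv (fun σ : ℝ => Real.log ‖Literature.NumberTheory.LFunctions.riemannXi (σ : ℂ)‖))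

/-- item stmt-RiemannHypothesis-0455 · support · rank 4 · closed · proved by Summit.RiemannHypothesis.RiemannHypothesis.Theorems.leeYangCircleTheoremFinite_proof (prover) · by planner
sources: LeeYang1952 App. II; Ruelle1969 Prop 5.1.1 + (1.8) pp.94–96 (grounder page-level check), tree: named fact Literature.Probability.LatticeModels.lee_yang_circle_theorem_finite (verbatim this signature); Literature.Probability.LatticeModels.lee_yang_ising_of_pos derived from it
For n sites, couplings J i j ≥ 0 (any matrix; the double sum just doubles couplings and adds a
constant diagonal) and complex fields h_i with Re h_i > 0 for all i, the partition function Σ_{σ ∈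
{±1}^n} exp(Σ_{i,j} J_ij σ_iσ_j + Σ_i h_i σ_i) ≠ 0 [LeeYang1952 App. II; Asano1970 (contraction
proof, ~2 pages, induction on edges); Ruelle2010 §1]. Pure-Mathlib statement; the engine of assembly
#1 and the first declaration of the requested Literature/Probability/LatticeModels/LeeYang.lean.
Corollary wanted there: for λ ≥ 0 the law of Σ λ_i σ_i has the Lee–Yang property (set h_i = λ_i h). -/
@[route_item "route-RiemannHypothesis-LeeYang"]
def LeeYangCircleTheoremFinite : Prop :=
  ∀ (n : ℕ) (J : Fin n → Fin n → ℝ) (h : Fin n → ℂ), (∀ i j, 0 ≤ J i j) → (∀ i, 0 < (h i).re) → (∑ σ : Fin n → Bool, Complex.exp ((∑ i, ∑ j, ((J i j : ℂ) * (if σ i = σ j then 1 else -1))) + ∑ i, h i * (if σ i then 1 else -1))) ≠ 0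

/-- item stmt-RiemannHypothesis-0456 · support · rank 5 · closed · proved by Summit.RiemannHypothesis.LeeYang.leeyangCumulantAlternationXi_proof @ be0f49fdb05a (prover) · by planner
why it might fail: Not expected to fail: sign forced by the first zero pair. Only a bookkeeping slip in (log ξ)^{(2n)}(1/2) = −(2n−1)!·Σ_ρ(ρ−1/2)^{−2n} could change it.
sources: Newman1975 Thm 3 + (2.4) p.2 (sign rule for type-ℒ laws; conditional on LY ⇔ RH), PlattTrudgian2021 (RH verified far beyond the height 31 needed), tree: RiemannXiHadamardProduct.lean, ZetaLowHeightZeros, ZetaZeroReciprocalSum.lean, Literature.NumberTheory.LFunctions.xiTaylorCoeff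
Necessary for the Lee–Yang property of Φ du (hence for X and for RH): if all zeros of the even
entire function h ↦ ξ(1/2 + h/2) are imaginary, ±iγ_k, then log ξ(1/2 + h) = const + Σ_k log(1 +
h²/γ_k'²) has Taylor coefficients of alternating sign [Newman1975 Thm 3 (sign of Ursell functions
under Lee–Yang)]; n = 2 is the Lebowitz inequality u₄ ≤ 0 (Literature.StatMech.lebowitz is the
Ising-side fact). Unconditionally (−1)^{n+1}(log ξ)^{(2n)}(1/2) = (2n−1)!·Re Σ_ρ (−1)^{n+1}(1/2 −
ρ)^{−2n}; the first zero 1/2 + 14.1347i (on the line, simple) dominates for n ≥ n₀ and any off-line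
zero has |ρ − 1/2| > 3·10^{12} [PlattTrudgian2021], so the statement is PROVABLE by certified
computation for n < n₀ plus a domination lemma — a formal target exercising ξ-derivative numerics
(cf. Literature.NumberTheory.LFunctions.xiTaylorCoeff in RiemannXi.lean: (log ξ)^{(2n)}(1/2) is a
polynomial in xiTaylorCoeff 0..2n). -/
@[route_item "route-RiemannHypothesis-LeeYang"]
def LeeyangCumulantAlternationXi : Prop :=
  ∀ n : ℕ, 1 ≤ n → 0 < (-1 : ℝ) ^ (n + 1) * iteratedDeriv (2 * n) (fun σ : ℝ => Real.log ‖Literature.NumberTheory.LFunctions.riemannXi (σ : ℂ)‖) (1 / 2)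

/-- item stmt-RiemannHypothesis-17751 · support · rank 9 · open · by planner
[support] Contrapositive face of #9 `LeeyangThesisImpliesRH`: if RH fails then the thesis X fails,
i.e. `LeeyangNeg` (literally ¬X,
`Summit.RiemannHypothesis.LeeYang.leeyangNeg_iff_not_leeyangThesis`) holds — the route's kill
interface stated as ONE registered implication (same shape as OddSector's `¬ RiemannHypothesis → …`
items). KNOWN/provable now in one line from tree theorems (`leeyangNeg_iff_not_leeyangThesis.2 fun
hX => h (closes hX)`; Newman closure `hasLeeYangProperty_of_isIsingLimitLaw_holds` + Pólya
`riemannHypothesis_of_deBruijnPhi_laplace_zeros_holds`). PURPOSE = HYGIENE (route-repair 2026-08-17,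
tree.conditional lint): this item is the registered home of the bookkeeping theorem
`Summit.RiemannHypothesis.LeeYang.leeyangNeg_of_not_riemannHypothesis (hN :
hasLeeYangProperty_of_isIsingLimitLaw) (h : ¬ Summit.RiemannHypothesis) : LeeyangNeg` in
Theorems/LeeYangLeeyangThesis.lean, whose unregistrable hypotheses (`Not`-headed ¬RH; the
now-DISCHARGED named fact hN) make it — and `riemannHypothesis_of_leeyangThesis`,
`riemannHypothesis_of_isIsingLimitLaw_of_eq` in the same file — `proof.conditional`. PROVER: do NOT
close this with a new file that calls the old conditional theo -/
@[route_item "route-RiemannHypothesis-LeeYang"]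
def NotRHImpliesLeeyangNeg : Prop :=
  ¬ _root_.Summit.RiemannHypothesis → LeeyangNeg

/-- item stmt-RiemannHypothesis-8946 · support · rank 9 · closed · proved by Summit.RiemannHypothesis.RiemannHypothesis.Theorems.leeyangThesisImpliesRH_proof (prover) · by planner
sources: tree: certified replacement of Theorems/LeeYangLeeyangThesis.lean attached as evidence to stmt-RiemannHypothesis-8946 (route-repair g3 2026-08-16; lean check rc 0, 0 sorries, audit ok) — theorem leeyangThesisImpliesRH, Literature.Probability.LatticeModels.hasLeeYangProperty_of_isIsingLimitLaw_holds (Newman1974 Thm 3 / LiebSokal1981), Literature.NumberTheory.LFunctions.riemannHypothesis_of_deBruijnPhi_laplace_zeros_holds (Pólya representation)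
@item_informal.txt -/
@[route_item "route-RiemannHypothesis-LeeYang"]
def LeeyangThesisImpliesRH : Prop :=
  LeeyangThesis → Summit.RiemannHypothesis

/-- item stmt-RiemannHypothesis-0452 · assembly · rank 1 · closed · proved by Summit.RiemannHypothesis.RiemannHypothesis.Theorems.leeYangAssembly_proof @ 1a81be5e7dce (prover) · by planner
Typed half: if every zero z of ∫_ℝ e^{zu} Φ(u) du is purely imaginary then RH. Proof: ∫ e^{zu}Φ =
2·Literature.NumberTheory.LFunctions.deBruijnH 0 (I·z)·(sign conventions: cos(izu) = cosh(zu), Φ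
even by fact deBruijnPhi_neg), so HasOnlyRealZeros (deBruijnH 0) and RH by fact
Literature.NumberTheory.LFunctions.riemannHypothesis_iff_hasOnlyRealZeros_deBruijnH_zero. Untyped
half (needs IsIsingLimitLaw): X → hypothesis, by (a) Lee–Yang circle theorem for finite spin-½
ferromagnets (crux #4; [LeeYang1952; Asano1970]) giving zeros of h ↦ E_k e^{hM_k} on Re h = 0, (b)
uniform Gaussian moments ⇒ locally uniform convergence of the entire functions h ↦ ∫e^{hu}dν_k, (c)
Hurwitz. Expected as (h₁ : lee_yang_ising) (h₂ : hasLeeYangProperty_of_isIsingLimitLaw) once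
LeeYang.lean exists. -/
@[route_item "route-RiemannHypothesis-LeeYang"]
def Assembly : Prop :=
  (∀ z : ℂ, (∫ u : ℝ, Complex.exp (z * u) * (Literature.NumberTheory.LFunctions.deBruijnPhi u : ℂ)) = 0 → z.re = 0) → Summit.RiemannHypothesis

/-! D-0027 §2.1 — DECIDING THEOREM (planner-authored via `route open/edit --closes-file`; by planner-rbadge-RiemannHypothesis-LeeYang-aa20217c-g3-0 2026-08-16T05:18:36Z):
its hypotheses are this route's items and its conclusion the sub-problem Statement (glue_lint), and it elaborates with this file. -/

@[closes "route-RiemannHypothesis-LeeYang"] theorem closes (hX : LeeyangThesis) :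
    _root_.Summit.RiemannHypothesis := by
  -- the Pólya–de Bruijn kernel `Φ` and its normalising constant `∫ Φ ∈ (0, ∞)`
  have hmeas : Measurable fun u : ℝ =>
      ENNReal.ofReal (Literature.NumberTheory.LFunctions.deBruijnPhi u) :=
    Literature.NumberTheory.LFunctions.continuous_deBruijnPhi.measurable.ennreal_ofReal
  have hint : Integrable Literature.NumberTheory.LFunctions.deBruijnPhi := by
    refine (Literature.NumberTheory.LFunctions.integrable_exp_mul_deBruijnPhi 0).re.congr
      (Eventually.of_forall fun u => ?_)
    simp
  have htop : (∫⁻ u, ENNReal.ofReal (Literature.NumberTheory.LFunctions.deBruijnPhi u)) ≠ ⊤ :=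
    hint.lintegral_lt_top.ne
  have hzero : (∫⁻ u, ENNReal.ofReal (Literature.NumberTheory.LFunctions.deBruijnPhi u)) ≠ 0 := by
    refine ((lintegral_pos_iff_support hmeas).2 ?_).ne'
    have : support (fun u : ℝ =>
        ENNReal.ofReal (Literature.NumberTheory.LFunctions.deBruijnPhi u)) = univ := by
      refine eq_univ_of_forall fun u => ?_
      simp only [mem_support, ne_eq, ENNReal.ofReal_eq_zero, not_le]
      exact Literature.NumberTheory.LFunctions.deBruijnPhi_pos_holds u
    simp [this]
  -- the normalised law `ν_Φ = Φ du / ∫Φ` is a probability measure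
  have hprob : IsProbabilityMeasure
      ((∫⁻ u, ENNReal.ofReal (Literature.NumberTheory.LFunctions.deBruijnPhi u))⁻¹ •
        volume.withDensity (fun u : ℝ =>
          ENNReal.ofReal (Literature.NumberTheory.LFunctions.deBruijnPhi u))) := by
    refine ⟨?_⟩
    rw [Measure.smul_apply, withDensity_apply _ MeasurableSet.univ, Measure.restrict_univ,
      smul_eq_mul, ENNReal.inv_mul_cancel hzero htop]
  -- X: `ν_Φ` is an Ising limit law; Newman's closure theorem: it has the Lee–Yang property
  have hLY := Literature.Probability.LatticeModels.hasLeeYangProperty_of_isIsingLimitLaw_holds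
    ⟨_, hprob⟩ (hX ⟨_, hprob⟩ rfl)
  -- Pólya's representation `∫ e^{zu} Φ = 2·H₀(iz)`: imaginary Laplace zeros of `Φ du` give RH
  refine Literature.NumberTheory.LFunctions.riemannHypothesis_of_deBruijnPhi_laplace_zeros_holds
    fun z hz => hLY z ?_
  -- the Laplace transform of `ν_Φ` is `(∫Φ)⁻¹ ∫ e^{zu} Φ(u) du`, hence vanishes at `z` too
  change ∫ u, Complex.exp (z * u) ∂((∫⁻ u,
      ENNReal.ofReal (Literature.NumberTheory.LFunctions.deBruijnPhi u))⁻¹ •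
        volume.withDensity (fun u : ℝ =>
          ENNReal.ofReal (Literature.NumberTheory.LFunctions.deBruijnPhi u))) = 0
  rw [integral_smul_measure, integral_withDensity_eq_integral_toReal_smul hmeas
      (Eventually.of_forall fun _ => ENNReal.ofReal_lt_top), smul_eq_zero]
  refine Or.inr ?_
  rw [← hz]
  refine integral_congr_ae (Eventually.of_forall fun u => ?_)
  simp only [ENNReal.toReal_ofReal (Literature.NumberTheory.LFunctions.deBruijnPhi_pos_holds u).le,
    Complex.real_smul, mul_comm]

end Summit.RiemannHypothesis.RiemannHypothesis.Theses.LeeYang
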